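import Mathlib.MeasureTheory.Integral.Bochner.Basic
import Mathlib.Algebra.Ring.NegOnePow
import Literature.NumberTheory.EllipticCurves.Newforms
import HarnessLib

/-!
# Rationality of the critical values / period polynomials of a newform (Manin; Paşol–Popa)

Number-theory named-fact file (modular forms vocabulary of
`Literature/NumberTheory/EllipticCurves/Newforms.lean`). Source: V. Paşol, A. A. Popa, *Modular
forms and period polynomials*, Proc. LMS 107 (2013) 713–743 = arXiv:1202.5802 [PasolPopa2013],
§5.3 "Rationality of period polynomials of Hecke eigenforms", Prop. 5.11 and Cor. 5.12 (with
eq. (5.7): `r_{I,n}(f) = i^{n+1} Λ(n+1, f)`, `Λ(s,f) := (2π)^{-s} Γ(s) L(s,f)`); for level one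
this is Manin's Periods Theorem (Ju. I. Manin, *Periods of parabolic forms and p-adic Hecke
series*, Math. USSR Sb. 21 (1973), Thm. 1.3 [Manin1973]).

## The source statements

Prop. 5.11: for a newform `f ∈ S_k(N, χ)` with coefficient field `K_f`: (a) there are nonzero
`ω_f^+, ω_f^- ∈ ℂ` such that all components of `ρ_f^± / ω_f^±` have coefficients in `K_f`;
(b) `ω_f^+ conj(ω_f^-) / (i (2π)^{k-1} (f,f)) ∈ K_f` if `k` is even,
`|ω_f^±|² / ((2π)^{k-1} (f,f)) ∈ K_f` if `k` is odd; (c) if `f` has real Fourier coefficients at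
infinity then `ω_f^+ ∈ i^{k+1} ℝ` and `ω_f^- ∈ i^k ℝ`. Cor. 5.12: with these periods,
`i^n Λ(n, f) / ω_f^± ∈ K_f` for `0 < n < k`, `(-1)^n = ± (-1)^{k-1}`.

## What is vendored

`PasolPopa2013_criticalValuesRationality`: for a newform `f ∈ S_k(Γ₀(N))` (trivial Nebentypus —
the case the tree's `IsNewform0` names; `S_k(N, 𝟙) = S_k(Γ₀(N))`), there exist nonzero
`ω⁺, ω⁻ ∈ ℂ` satisfying the conclusion of Cor. 5.12 together with Prop. 5.11 (b) and (c). This is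
a CONSEQUENCE of Prop. 5.11 + Cor. 5.12 as printed (the periods there are the specific ones of
5.11(a); the full statement (a) about all coset components of the period polynomials `ρ_f^±` is
not transcribed — the tree has the period cocycle `periodFn` of `EichlerShimuraPeriods` but not
Paşol–Popa's `ρ^±` decomposition — so only the identity-coset consequences are recorded).

* `completedLValue f n = ∫₀^∞ f(it) t^{n-1} dt`, the Mellin integral, which for a cusp form
  converges for every `n` and equals Paşol–Popa's `Λ(n, f) = (2π)^{-n} Γ(n) L(n, f)` (integral
  representation of `L(f,s)`; Shimura 1971, (3.5.?) / Diamond–Shurman §5.10; PP eq. (5.7):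
  `∫₀^{i∞} f(z) zⁿ dz = i^{n+1} Λ(n+1, f)`). In the notation of route `DeltaPeriodAudit`,
  `s_j(f) = ∫₀^∞ f(it) tʲ dt = completedLValue f (j+1)`.
* `K_f = coeffField f` (tree), `(f,f) = peterssonProduct (Γ₀(N)) k f f` (tree; it is a positive
  RATIONAL multiple — `c ∈ {1,2}` times the index normalisation `[Γ̄₁ : Γ̄₀(N)]` of PP §3 — of
  Paşol–Popa's `(f,f)`, which does not affect membership in `K_f ⊇ ℚ`).
* Parities: `(-1)^n = (-1)^{k-1}` is `Int.negOnePow n = Int.negOnePow (k-1)` (sign `+`, period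
  `ω⁺`), the other parity uses `ω⁻` (PP: "when `k` is even … `ω_f^+` is the normalizing factor for
  odd critical values").
* On `Γ₀(N)` nonzero cusp forms have even weight (`eq_zero_of_odd_weight_gamma0`), so the odd-`k`
  clause of (b) is vacuous there; it is kept as printed.

## References

* V. Paşol, A. A. Popa, Proc. LMS 107 (2013) 713–743, arXiv:1202.5802 [PasolPopa2013]: §5.3,
  Prop. 5.11, eq. (5.7), Cor. 5.12.
* Ju. I. Manin, Math. USSR Sb. 21 (1973) 371–393 [Manin1973]: Thm. 1.3 (level `1`).
* G. Shimura, *On the periods of modular forms*, Math. Ann. 229 (1977), Thm. 1 (cited by PP as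
  [Sh77]; Cor. 5.12 is a special case).
-/

noncomputable section

open scoped MatrixGroups ModularForm
open CongruenceSubgroup UpperHalfPlane MeasureTheory

namespace Literature.NumberTheory.EllipticCurves.ModularForms

section CriticalValues

variable {Γ : Subgroup (GL (Fin 2) ℝ)} {k : ℤ}

/-- The **completed critical value as a Mellin integral**:
`completedLValue f n = ∫₀^∞ f(it) t^{n-1} dt`, which for a cusp form converges for every `n` and
equals `Λ(n, f) = (2π)^{-n} Γ(n) L(n, f)` (Paşol–Popa, eq. (5.7): `∫₀^{i∞} f(z) zⁿ dz =
i^{n+1} Λ(n+1, f)`; integral representation of the `L`-series of a cusp form). Defined for any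
`f : ℍ → ℂ`-valued form; the route `DeltaPeriodAudit` writes `s_j(f) = completedLValue f (j+1)`.
[cite: PasolPopa2013, §5.3 eq. (5.7)] -/
def completedLValue (f : CuspForm Γ k) (n : ℕ) : ℂ :=
  ∫ t in Set.Ioi (0 : ℝ), ((t : ℂ) ^ (n - 1)) * f (UpperHalfPlane.ofComplex ((t : ℂ) * Complex.I))

/-- Unfolding lemma for `completedLValue`. [folklore] -/
theorem completedLValue_def (f : CuspForm Γ k) (n : ℕ) :
    completedLValue f n =
      ∫ t in Set.Ioi (0 : ℝ), ((t : ℂ) ^ (n - 1)) * f (UpperHalfPlane.ofComplex ((t : ℂ) * Complex.I)) :=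
  rfl

/-- A cusp form **has real Fourier coefficients at infinity** if all its period-`1`
`q`-expansion coefficients are real (Paşol–Popa, Prop. 5.11(c)). [cite: PasolPopa2013, Prop. 5.11(c)] -/
def HasRealCoefficients (f : CuspForm Γ k) : Prop :=
  ∀ n : ℕ, ((qExpansion 1 ⇑f).coeff n).im = 0

end CriticalValues

section Fact

/-- **Rationality of the critical values and parity of the periods of a newform**
(Paşol–Popa 2013, Prop. 5.11 (b),(c) with Cor. 5.12; Manin 1973, Thm. 1.3 for level one).
For every newform `f ∈ S_k(Γ₀(N))` with coefficient field `K_f` there exist nonzero complex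
numbers `ω⁺, ω⁻` (the periods `ω_f^±` of Prop. 5.11(a)) such that
* (Cor. 5.12) for `0 < n < k`: `iⁿ Λ(n, f) / ω⁺ ∈ K_f` when `(-1)ⁿ = (-1)^{k-1}` and
  `iⁿ Λ(n, f) / ω⁻ ∈ K_f` when `(-1)ⁿ = -(-1)^{k-1}`;
* (5.11(b)) `ω⁺ conj(ω⁻) / (i (2π)^{k-1} (f,f)) ∈ K_f` if `k` is even, and
  `|ω^±|² / ((2π)^{k-1} (f,f)) ∈ K_f` if `k` is odd;
* (5.11(c)) if `f` has real Fourier coefficients then `ω⁺ ∈ i^{k+1} ℝ` and `ω⁻ ∈ i^k ℝ`.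
Here `Λ(n,f) = completedLValue f n` (Mellin integral = `(2π)^{-n}Γ(n)L(n,f)`, eq. (5.7)) and
`(f,f)` is the tree's `peterssonProduct` (a positive rational multiple of Paşol–Popa's). [cite: PasolPopa2013, Prop. 5.11 (b),(c) and Cor. 5.12] -/
def PasolPopa2013_criticalValuesRationality : Prop :=
  ∀ (N : ℕ) [NeZero N] (k : ℤ) (f : CuspForm (Gamma0 N) k), IsNewform0 f →
    ∃ ωp ωm : ℂ, ωp ≠ 0 ∧ ωm ≠ 0 ∧
      (∀ n : ℕ, 0 < n → (n : ℤ) < k →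
        ((n : ℤ).negOnePow = (k - 1).negOnePow →
          Complex.I ^ n * completedLValue f n / ωp ∈ coeffField f) ∧
        ((n : ℤ).negOnePow = -(k - 1).negOnePow →
          Complex.I ^ n * completedLValue f n / ωm ∈ coeffField f)) ∧
      (Even k → ωp * (starRingEnd ℂ) ωm /
          (Complex.I * (2 * Real.pi : ℂ) ^ (k - 1) * peterssonProduct (Gamma0 N) k f f) ∈
        coeffField f) ∧
      (Odd k →
        ((‖ωp‖ ^ 2 : ℝ) : ℂ) / ((2 * Real.pi : ℂ) ^ (k - 1) * peterssonProduct (Gamma0 N) k f f) ∈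
          coeffField f ∧
        ((‖ωm‖ ^ 2 : ℝ) : ℂ) / ((2 * Real.pi : ℂ) ^ (k - 1) * peterssonProduct (Gamma0 N) k f f) ∈
          coeffField f) ∧
      (HasRealCoefficients f →
        (∃ r : ℝ, ωp = Complex.I ^ (k + 1) * r) ∧ (∃ r : ℝ, ωm = Complex.I ^ k * r))

end Fact

section Corollaries

/-- For a newform with RATIONAL coefficients (`K_f = ℚ`, the case of route `DeltaPeriodAudit`):
the critical values of the `+` parity are rational multiples of `ω⁺ / iⁿ`. A direct unpacking of
the fact. [cite: PasolPopa2013, Cor. 5.12] -/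
theorem PasolPopa2013_criticalValuesRationality.exists_rat_of_coeffField_eq_bot
    (h : PasolPopa2013_criticalValuesRationality) {N : ℕ} [NeZero N] {k : ℤ}
    {f : CuspForm (Gamma0 N) k} (hf : IsNewform0 f) (hK : coeffField f = ⊥) :
    ∃ ωp ωm : ℂ, ωp ≠ 0 ∧ ωm ≠ 0 ∧
      (∀ n : ℕ, 0 < n → (n : ℤ) < k → (n : ℤ).negOnePow = (k - 1).negOnePow →
        ∃ q : ℚ, Complex.I ^ n * completedLValue f n = q * ωp) ∧
      (∀ n : ℕ, 0 < n → (n : ℤ) < k → (n : ℤ).negOnePow = -(k - 1).negOnePow →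
        ∃ q : ℚ, Complex.I ^ n * completedLValue f n = q * ωm) := by
  obtain ⟨ωp, ωm, hp, hm, hval, -, -, -⟩ := h N k f hf
  refine ⟨ωp, ωm, hp, hm, fun n hn hnk hpar => ?_, fun n hn hnk hpar => ?_⟩
  · have hmem := (hval n hn hnk).1 hpar
    rw [hK, IntermediateField.mem_bot] at hmem
    obtain ⟨q, hq⟩ := hmem
    refine ⟨q, ?_⟩
    have : (algebraMap ℚ ℂ q) * ωp = Complex.I ^ n * completedLValue f n := by
      rw [hq, div_mul_cancel₀ _ hp]
    simpa using this.symm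
  · have hmem := (hval n hn hnk).2 hpar
    rw [hK, IntermediateField.mem_bot] at hmem
    obtain ⟨q, hq⟩ := hmem
    refine ⟨q, ?_⟩
    have : (algebraMap ℚ ℂ q) * ωm = Complex.I ^ n * completedLValue f n := by
      rw [hq, div_mul_cancel₀ _ hm]
    simpa using this.symm

end Corollaries

end Literature.NumberTheory.EllipticCurves.ModularForms
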